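import Summits.BirchSwinnertonDyer.BirchSwinnertonDyer.Theses.RamifiedHeegnerPair
import Summits.BirchSwinnertonDyer.Rank1Residual.X11b.CongruentSelmerTransfer

/-!
# Line `tamfreelower` for crux U₁ = `RamifiedHeegnerPair.LeafRankOneUpperAtThree` (item 26022)

Crux-ideate seat 2 gen 5 (planner), 2026-08-30. Skeleton of the crux idea `Ideas/tamfreelower.md`
(«Tamagawa-free double level-lowering»): on the unit habitat (`#Ш_an(E)` a 3-adic unit) with EXACTLY
TWO Tamagawa-3 carriers `ℓ₁, ℓ₂` and the coin «some Selmer class of `E[3]` is non-strict at a carrier»,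
the crux follows from ONE existence statement about a Selmer structure `𝓐` on `E[3]` that is the Kummer
structure off `{ℓ₁, ℓ₂}` and the UNRAMIFIED line at `ℓ₁, ℓ₂` («level-lowered signature») with
`#Sel(𝓐) = 3` and a class transversal at a carrier — intended witness (outside this file): the mod-`𝔭`
Selmer structure of the optimal quotient `A_g` of a newform `g ≡ f_E (mod 𝔭 ∣ 3)` LEVEL-LOWERED AT BOTH
carriers (even number of lowerings ⇒ same sign `−1`; `A_g` has no `𝔭`-Tamagawa factor anywhere), whose
`𝔭`-Selmer group is the line spanned by its Heegner class by Gross's `𝔭`-primitive theorem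
(Gross 1991 Prop. 2.1/2.3). The closing algebra is the tree's LANDED two-place congruent-transfer count
(`X11b.CongruentTransfer`: generator kill R1, pair index by Poitou–Tate + Euler–Poincaré, sandwich,
Cassels–Tate consumer with `k ≤ r_an + 1 = 2`). Three stubs + the kernel-checked composition
`LeafRankOneUpperAtThree_of`, which also takes the route's PRINT item PUB⁺ =
`LeafRankOnePrintedInputsAtThree` (item 27491) BY NAME, as the route's `closes` does.
Nothing here is proved except the composition; BSD is proved for no curve here; typed ≠ proved.
-/

noncomputable section

open scoped Classical

open NumberField IsDedekindDomain WeierstrassCurve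
open Literature.NumberTheory.EllipticCurves
open Literature.NumberTheory.EllipticCurves.Rank1Residual
open Literature.NumberTheory.GaloisRepresentations
open Literature.NumberTheory.GaloisRepresentations.DiscreteGaloisModule (SelmerStructure unramifiedSubgroup)
open Literature.NumberTheory.GaloisCohomology
open Summit.BirchSwinnertonDyer.Rank1Residual.X11b.CongruentTransfer

namespace Summit.BirchSwinnertonDyer.BirchSwinnertonDyer.Cruxes.LeafRankOneUpperAtThree.Tamfreelower

/-- Hab₁(W) («unit habitat»): the analytic order of Ш is a `3`-adic unit (the tree's `hv` idiom of the
consumer `bsdp_of_exists_natCard_selmerGroup_le`; decidable per curve; holds on all 33 residue rows). -/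
def UnitHab (W : WeierstrassCurve ℚ) [W.IsElliptic] : Prop :=
  ∃ q : ℚ, shaAn W = (q : ℂ) ∧ padicValRat 3 q = 0

/-- «`ℓ₁, ℓ₂` are ALL the Tamagawa-3 carriers of `E`, and the two-place slack is `≤ 3²`», spelled on
`E[3]`-cohomology: `ℓᵢ ∤ 3`, the local Kummer condition at `ℓᵢ` is NOT the unramified line (⟺ `3 ∣ c_{ℓᵢ}`
for `ℓᵢ ∤ 3`), at every other finite `v ∤ 3` it IS the unramified line (no third carrier), and the
toolkit's slack `t_{ℓ₁} t_{ℓ₂} = #E(ℚ_{ℓ₁})[3]·#E(ℚ_{ℓ₂})[3] = 3^σ` with `σ ≤ 2`. -/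
def IsCarrierPair (W : WeierstrassCurve ℚ) [W.IsElliptic] (ℓ₁ ℓ₂ : HeightOneSpectrum (𝓞 ℚ)) : Prop :=
  ℓ₁ ≠ ℓ₂ ∧ ((3 : ℕ) : 𝓞 ℚ) ∉ ℓ₁.asIdeal ∧ ((3 : ℕ) : 𝓞 ℚ) ∉ ℓ₂.asIdeal ∧
  W.kummerSelmerStructure ((3 : ℕ) : ℤ) (Sum.inr ℓ₁) ≠
    unramifiedSubgroup (GaloisRep.toLocal ℓ₁ (W.torsionGaloisModule ((3 : ℕ) : ℤ))) 1 ∧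
  W.kummerSelmerStructure ((3 : ℕ) : ℤ) (Sum.inr ℓ₂) ≠
    unramifiedSubgroup (GaloisRep.toLocal ℓ₂ (W.torsionGaloisModule ((3 : ℕ) : ℤ))) 1 ∧
  (∀ v : HeightOneSpectrum (𝓞 ℚ), v ≠ ℓ₁ → v ≠ ℓ₂ → ((3 : ℕ) : 𝓞 ℚ) ∉ v.asIdeal →
    W.kummerSelmerStructure ((3 : ℕ) : ℤ) (Sum.inr v) =
      unramifiedSubgroup (GaloisRep.toLocal v (W.torsionGaloisModule ((3 : ℕ) : ℤ))) 1) ∧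
  ∃ σ : ℕ, σ ≤ 2 ∧
    (Nat.card (nsmulAddMonoidHom 3 : (W.baseChange (ℓ₁.adicCompletion ℚ)).toAffine.Point →+ _).ker *
        Nat.card (ℓ₁.adicCompletionIntegers ℚ ⧸ Ideal.span {((3 : ℕ) : ℓ₁.adicCompletionIntegers ℚ)})) *
      (Nat.card (nsmulAddMonoidHom 3 : (W.baseChange (ℓ₂.adicCompletion ℚ)).toAffine.Point →+ _).ker *
        Nat.card (ℓ₂.adicCompletionIntegers ℚ ⧸ Ideal.span {((3 : ℕ) : ℓ₂.adicCompletionIntegers ℚ)})) =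
      3 ^ σ

/-- The COIN at the pair: some `3`-Selmer class of `E` has NONZERO localisation at `ℓ₁` or at `ℓ₂`
(for a rank-one curve with `Ш[3] = 0`: the Mordell–Weil generator is not `3`-divisible in `E(ℚ_{ℓᵢ})`,
i.e. lies off the identity component at some carrier; decidable per curve). -/
def Coin (W : WeierstrassCurve ℚ) [W.IsElliptic] (ℓ₁ ℓ₂ : HeightOneSpectrum (𝓞 ℚ)) : Prop :=
  ∃ c ∈ (W.kummerSelmerStructure ((3 : ℕ) : ℤ)).selmerGroup,
    galoisCohomology.localization (W.torsionGaloisModule ((3 : ℕ) : ℤ)) (Sum.inr ℓ₁) 1 c ≠ 0 ∨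
      galoisCohomology.localization (W.torsionGaloisModule ((3 : ℕ) : ℤ)) (Sum.inr ℓ₂) 1 c ≠ 0

/-- The line's habitat Hab_TL(W): unit `#Ш_an`, a carrier pair, and the coin at it. -/
def Hab (W : WeierstrassCurve ℚ) [W.IsElliptic] : Prop :=
  UnitHab W ∧ ∃ ℓ₁ ℓ₂ : HeightOneSpectrum (𝓞 ℚ), IsCarrierPair W ℓ₁ ℓ₂ ∧ Coin W ℓ₁ ℓ₂

/-- STUB 1 (PRINT: three published duality theorems, vendored in `Literature` as named facts and used as
hypotheses by the tree's toolkit — Cassels–Tate (Silverman X.4.14 / Cassels 1962), Poitou–Tate for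
Selmer structures with real places (Milne ADT I.4.10), the local Euler–Poincaré characteristic
(Milne ADT I.2.8) at every finite place of `ℚ`). -/
theorem stub_printDuality :
    exists_casselsTate_pairing (K := ℚ) ∧ poitouTate_selmerStructure_duality_real ℚ ∧
      ∀ v : HeightOneSpectrum (𝓞 ℚ), localEulerPoincareCharacteristic (v.adicCompletion ℚ) := by
  sorry

/-- STUB 2 (THE RESEARCH LEAF «Tamagawa-free lowered partner», IDEA-NEEDED class-wide, INSTRUMENTABLE per
row): on the habitat, for every carrier pair carrying the coin there is a Selmer structure `𝓐` on `E[3]`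
equal to the Kummer structure off `{ℓ₁, ℓ₂}` and to the UNRAMIFIED line at `ℓ₁` and at `ℓ₂`, with
`#Sel(𝓐) = 3` and a class of `Sel(𝓐)` with nonzero localisation at `ℓ₁` or `ℓ₂`. Intended witness: the
mod-`𝔭` Selmer structure of the optimal quotient `A_g` of a newform `g ≡ f_E (mod 𝔭)`, `𝔭 ∣ 3`,
level-lowered at BOTH carriers (Carayol / Diamond–Taylor at an additive carrier `q² → q`, Ribet at a
split multiplicative one `q → 1`; sign unchanged), `Sel(𝓐) = Sel_𝔭(A_g/ℚ) = 𝔽_𝔭 · δ y_g` by Gross's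
`𝔭`-primitive theorem for `(A_g, K, 𝔭)` GIVEN `y_g ∉ 𝔭 A_g(K)` and `loc_{ℓᵢ} δy_g ≠ 0` (GP: the class-wide
open input; per row a finite cubic-residue computation). -/
theorem stub_tamagawaFreePartner :
    ∀ (W : WeierstrassCurve ℚ) [W.IsElliptic] [W.IsGloballyMinimal], ¬ W.HasCM → Addv W 3 →
      Summit.BirchSwinnertonDyer.Rank1Residual.Additive.SubGss W 3 → W.analyticRank = 1 → UnitHab W →
      ∀ ℓ₁ ℓ₂ : HeightOneSpectrum (𝓞 ℚ), IsCarrierPair W ℓ₁ ℓ₂ → Coin W ℓ₁ ℓ₂ →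
      ∃ 𝓐 : SelmerStructure (W.torsionGaloisModule ((3 : ℕ) : ℤ)),
        (∀ v ∉ ({(Sum.inr ℓ₁ : Place ℚ), Sum.inr ℓ₂} : Finset (Place ℚ)),
          𝓐 v = W.kummerSelmerStructure ((3 : ℕ) : ℤ) v) ∧
        𝓐 (Sum.inr ℓ₁) = unramifiedSubgroup (GaloisRep.toLocal ℓ₁ (W.torsionGaloisModule ((3 : ℕ) : ℤ))) 1 ∧
        𝓐 (Sum.inr ℓ₂) = unramifiedSubgroup (GaloisRep.toLocal ℓ₂ (W.torsionGaloisModule ((3 : ℕ) : ℤ))) 1 ∧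
        Nat.card 𝓐.selmerGroup = 3 ∧
        ∃ v ∈ ({(Sum.inr ℓ₁ : Place ℚ), Sum.inr ℓ₂} : Finset (Place ℚ)), ∃ c ∈ 𝓐.selmerGroup,
          galoisCohomology.localization (W.torsionGaloisModule ((3 : ℕ) : ℤ)) v 1 c ≠ 0 := by
  sorry

/-- STUB 3 (RESIDUAL off the habitat — non-unit `#Ш_an`, `≠ 2` carriers, two-place slack `3³`, or the
coin failing at every carrier pair; fed by the route's line of record Σ★⁸ + L₀; known support on the 33
residue rows: `485100gm1` (three carriers) and the rows failing the coin ∕ slack test, a per-row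
decidable list). -/
theorem stub_offHabitat :
    ∀ (W : WeierstrassCurve ℚ) [W.IsElliptic] [W.IsGloballyMinimal], ¬ W.HasCM → Addv W 3 →
      Summit.BirchSwinnertonDyer.Rank1Residual.Additive.SubGss W 3 → W.analyticRank = 1 →
      ¬ Hab W → Typed.MissingUpperBoundAt W 3 := by
  sorry

/-- COMPOSITION (kernel-checked, no `sorry`): PUB⁺ (item 27491, by name, as `hP` in the route's `closes`)
and the three stubs give the crux BY NAME. On the habitat: R1 generator kill
(`natCard_selmerGroup_kummerStrict_eq_one_of_generator`) ⇒ `Sel_{𝓚,S} = 0`; pair index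
(`relIndex_kummerStrict_kummerRelaxed_pair_eq_of_facts`) ⇒ `[𝓚^S : 𝓚_S] = 3^σ`; sandwich
(`exists_natCard_selmerGroup_eq_pow_le`) ⇒ `#Sel₃(E) = 3^k`, `k ≤ σ ≤ 2 = r_an + 1`; Cassels–Tate consumer
(`bsdp_of_exists_natCard_selmerGroup_le`) ⇒ `BSD₃(E)` ⇒ the upper half. Off the habitat: stub 3. -/
theorem LeafRankOneUpperAtThree_of
    (hP : Summit.BirchSwinnertonDyer.BirchSwinnertonDyer.Theses.RamifiedHeegnerPair.LeafRankOnePrintedInputsAtThree)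
    (h1 : exists_casselsTate_pairing (K := ℚ) ∧ poitouTate_selmerStructure_duality_real ℚ ∧
      ∀ v : HeightOneSpectrum (𝓞 ℚ), localEulerPoincareCharacteristic (v.adicCompletion ℚ))
    (h2 : ∀ (W : WeierstrassCurve ℚ) [W.IsElliptic] [W.IsGloballyMinimal], ¬ W.HasCM → Addv W 3 →
      Summit.BirchSwinnertonDyer.Rank1Residual.Additive.SubGss W 3 → W.analyticRank = 1 → UnitHab W →
      ∀ ℓ₁ ℓ₂ : HeightOneSpectrum (𝓞 ℚ), IsCarrierPair W ℓ₁ ℓ₂ → Coin W ℓ₁ ℓ₂ →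
      ∃ 𝓐 : SelmerStructure (W.torsionGaloisModule ((3 : ℕ) : ℤ)),
        (∀ v ∉ ({(Sum.inr ℓ₁ : Place ℚ), Sum.inr ℓ₂} : Finset (Place ℚ)),
          𝓐 v = W.kummerSelmerStructure ((3 : ℕ) : ℤ) v) ∧
        𝓐 (Sum.inr ℓ₁) = unramifiedSubgroup (GaloisRep.toLocal ℓ₁ (W.torsionGaloisModule ((3 : ℕ) : ℤ))) 1 ∧
        𝓐 (Sum.inr ℓ₂) = unramifiedSubgroup (GaloisRep.toLocal ℓ₂ (W.torsionGaloisModule ((3 : ℕ) : ℤ))) 1 ∧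
        Nat.card 𝓐.selmerGroup = 3 ∧
        ∃ v ∈ ({(Sum.inr ℓ₁ : Place ℚ), Sum.inr ℓ₂} : Finset (Place ℚ)), ∃ c ∈ 𝓐.selmerGroup,
          galoisCohomology.localization (W.torsionGaloisModule ((3 : ℕ) : ℤ)) v 1 c ≠ 0)
    (h3 : ∀ (W : WeierstrassCurve ℚ) [W.IsElliptic] [W.IsGloballyMinimal], ¬ W.HasCM → Addv W 3 →
      Summit.BirchSwinnertonDyer.Rank1Residual.Additive.SubGss W 3 → W.analyticRank = 1 →
      ¬ Hab W → Typed.MissingUpperBoundAt W 3) :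
    Summit.BirchSwinnertonDyer.BirchSwinnertonDyer.Theses.RamifiedHeegnerPair.LeafRankOneUpperAtThree := by
  intro W _ _ hCM hAdd hGss hr
  by_cases hab : Hab W
  · obtain ⟨hunit, ℓ₁, ℓ₂, hpair, hcoin⟩ := hab
    obtain ⟨𝓐, hagree, -, -, hcard, v, hvS, c, hc, hloc⟩ := h2 W hCM hAdd hGss hr hunit ℓ₁ ℓ₂ hpair hcoin
    obtain ⟨q, hq, hvq⟩ := hunit
    obtain ⟨hne, -, -, -, -, -, σ, hσ2, hσ⟩ := hpair
    obtain ⟨hCT, hPT, hEP⟩ := h1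
    have hGZK : rank_eq_analyticRank_of_analyticRank_le_one := hP.2.2.1
    have hr1 : W.analyticRank ≤ 1 := hr.le
    have hstrict := natCard_selmerGroup_kummerStrict_eq_one_of_generator W 3
      ({(Sum.inr ℓ₁ : Place ℚ), Sum.inr ℓ₂} : Finset (Place ℚ)) hagree hcard hc hvS hloc
    have hidx := (relIndex_kummerStrict_kummerRelaxed_pair_eq_of_facts W 3 hPT hEP hne).trans hσ
    have hk := exists_natCard_selmerGroup_eq_pow_le W 3
      ({(Sum.inr ℓ₁ : Place ℚ), Sum.inr ℓ₂} : Finset (Place ℚ)) hstrict hidx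
    have hB : BSDp W 3 :=
      bsdp_of_exists_natCard_selmerGroup_le W 3 hCT hGZK hr1 hq hvq hk (by rw [hr]; omega)
    haveI : Finite W.sha := (hGZK W hr1).2
    exact (Typed.lower_and_upper_of_missingPPartAt W 3 (Typed.missingPPartAt_of_bsdp W 3 hB)).2
  · exact h3 W hCM hAdd hGss hr hab

end Summit.BirchSwinnertonDyer.BirchSwinnertonDyer.Cruxes.LeafRankOneUpperAtThree.Tamfreelower

end
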